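import Summits.BirchSwinnertonDyer.BirchSwinnertonDyer.Theorems.SchneiderFreeSocketsV2
import Summits.BirchSwinnertonDyer.Rank1Residual.X11b.TamagawaHeegnerExact
import Summits.BirchSwinnertonDyer.Rank1Residual.X11b.AnticyclotomicLinks
import Literature.NumberTheory.EllipticCurves.BSDQuadraticDescentTorsionOddPartProofs
import HarnessLib

/-!
# Route `SchneiderFreeAdditiveX3` (rung K1 door) — STEP L♯ and T-B6-1♯ are EQUIVALENT pair by pair,
# given the control equality and Kolyvagin (the logic of the route's «cheapest falsifier»; Theses-free)

Seat `bsd-schneider-door-c5` (prover, gen 7). The route header (rev 15) says of the target `StepLManin`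
«it is exactly as strong as the two branch cruxes» and, under CHEAPEST FALSIFIER, «given the PROVED control
corner, each branch crux at a pair is numerically EQUIVALENT to STEP L there». The tree so far holds one
direction (`index_le_slack_of_additive_links`, sockets v2; door-c2's `stepLManin_of_kolyvagin_of_cruxes`;
the closed item `StepLManinLinkLe`). This file records the EQUIVALENCE in socket currency, without
importing the route file (standing build rule 2026-08-26: record files import the sockets, not `Theses`):

* (pointwise, at one frame `(κ, γ, 𝔭, ι)`: given the control EQUALITY `AdditiveControlOnTreeAt`
  (`ord_p f(0) = ord_p #Ш(E/K)[p^∞] + 2(ord_p log_ω P − ord_p[E(K):ℤP]) + ord_p ∏_{w∣N⁺} c_w`), the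
  slack-`s` branch inequality `AdditiveIMCLowerBDPOnTreeLeAt … s P` (`2·ord_p log_ω P ≤ ord_p f(0) + 2s`)
  is EQUIVALENT to the index inequality `2·ord_p[E(K):ℤP] ≤ ord_p #Ш(E/K)[p^∞] + ord_p ∏ c_w + 2s` —
  door-c2's `SchneiderFree.additiveIMCLowerBDPOnTreeLeAt_iff_index_le_of_control`, in a Theses-importing
  module, so inlined here rather than imported.)
* §1 at one Heegner datum over a classical Heegner field with `Ш(E/K)` finite: the index inequality in
  `Ш[p^∞]`/`∏_w c_w` currency is `IndexLowerBoundLeAt W p K P s` (`Ш`/`2·∏_ℓ c_ℓ` currency) — the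
  Tamagawa transport for every `p` (`X11b.padicValNat_tamagawaProduct*_of_heegner_prime`) and
  `ord_p #Ш[p^∞] = ord_p #Ш` (`indexLowerBoundLeAt_iff_of_heegner_of_shaFinite`); hence STEP L at the
  datum + control at a frame ⟹ T-B6-1 at that frame
  (`additiveIMCLowerBDPOnTreeLeAt_of_indexLowerBoundLeAt_of_control`).
* §2 on a pair `(W, p)`: given Kolyvagin's theorem for `W` (finiteness of `Ш(E/K)` at a non-torsion
  Heegner point — the `kolyvagin` conjunct of the route's `PrintedFacts`) and the Manin-robust control input
  `AdditiveControlInputManinAt W p` (the conclusion of the control corner, items 19295/19548), the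
  Manin-robust STEP L input and the Manin-robust branch-IMC/BDP input are EQUIVALENT:
  **`additiveStepLInputManinAt_iff_imcLowerBDPInputManinAt_of_kolyvagin_of_control`**. Read on the
  cells: `StepLManin|cell ⟺ PotMultBranchIMC` on (M), `⟺ GordTwoBranchIMC` on (G-ord, `e = 2`), given
  `AnticycControlAdditiveKF`'s conclusion and Kolyvagin — so a STEP-L counterexample at one pair/datum
  (the kit falsifier j261157 found none on 40 pairs: 40/40 with equality) refutes that cell's crux, and
  conversely the cruxes cost exactly STEP L, no more.

No named fact is used (Kolyvagin enters as an explicit hypothesis); nothing is asserted about BSD.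

References: [JetchevSkinnerWan2017] §7.3.1 (eq:tamK), §7.4.1 (eq:shalowerK-1) (arXiv:1512.06894 p. 30);
[Gross1991] Thm. 1.3, Conj. (2.2); [GreenbergLNM1716] §1.
-/

set_option autoImplicit false
set_option linter.dupNamespace false

noncomputable section

open scoped Classical

namespace Summit.BirchSwinnertonDyer.BirchSwinnertonDyer.Theorems.SchneiderFreeAdditiveX3

open WeierstrassCurve NumberField IsDedekindDomain Field
open Literature.NumberTheory.EllipticCurves
open Literature.NumberTheory.EllipticCurves.ModularForms
open Literature.NumberTheory.EllipticCurves.GreenbergSelmer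
open Literature.NumberTheory.EllipticCurves.Rank1Residual
open Literature.NumberTheory.EllipticCurves.Rank1Residual.Typed
open Summit.BirchSwinnertonDyer.Rank1Residual
open Summit.BirchSwinnertonDyer.Rank1Residual.X11b
open Summit.BirchSwinnertonDyer.Rank1Residual.X11b.AcSelmer
open Summit.BirchSwinnertonDyer.Rank1Residual.X11b.Halves
open Summit.BirchSwinnertonDyer.BirchSwinnertonDyer.Theorems.SchneiderFree

/-! ### §1 One Heegner datum: the two currencies of the index inequality agree

The pointwise form at one frame — given the control equality, slack-`s` T-B6-1 ⟺ the index inequality in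
`Ш[p^∞]`/`∏_w c_w` currency — is door-c2's `SchneiderFree.additiveIMCLowerBDPOnTreeLeAt_iff_index_le_of_control`
(`Theorems/SchneiderFreeAdditiveX3PotMultBranchIMCReductions.lean`, which imports the route file and is
therefore not imported here); its two-line `omega` content is inlined below. -/

section Datum

variable {p : ℕ} [Fact p.Prime] {K : Type} [Field K] [NumberField K]
  {W : WeierstrassCurve ℚ} {N : ℕ} {P : (W.baseChange K).toAffine.Point} {s : ℕ}

/-- **`IndexLowerBoundLeAt` in frame currency.** Over a classical Heegner field `K` for `N_E` (every
`ℓ ∣ N` has two primes above it) and with `Ш(E/K)` finite: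
`2·ord_p[E(K):ℤP] ≤ ord_p #Ш(E/K) + 2·ord_p ∏_ℓ c_ℓ(E) + 2s ⟺ 2·ord_p[E(K):ℤP] ≤ ord_p #Ш(E/K)[p^∞] +
ord_p ∏_{w∣N⁺} c_w(E/K) + 2s` — Tamagawa transport for EVERY `p`
(`ord_p ∏_{w∣N⁺} c_w = ord_p ∏_w c_w = 2·ord_p ∏_ℓ c_ℓ`) and `#Ш[p^∞] = p^{ord_p #Ш}` for finite `Ш`.
[cite: JetchevSkinnerWan2017, §7.3.1 (eq:tamK) (arXiv:1512.06894 p. 30)] -/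
theorem indexLowerBoundLeAt_iff_of_heegner_of_shaFinite [W.IsElliptic] (hN : W.conductorNorm ℤ = N)
    (hK : IsImaginaryQuadratic K) (hHe : SatisfiesHeegnerHypothesis N K)
    (hfin : (W.baseChange K).ShaFinite) :
    IndexLowerBoundLeAt W p K P s ↔
      2 * (padicValNat p (AddSubgroup.zmultiples P).index : ℤ) ≤
        (padicValNat p (Nat.card (AddCommGroup.primaryComponent (W.baseChange K).sha p)) : ℤ) +
          padicValNat p (X11b.tamagawaProductSplit W K) + 2 * (s : ℤ) := by
  have htam1 := X11b.padicValNat_tamagawaProductSplit_eq_of_heegner_prime (p := p) W K hN hHe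
  have htam2 := X11b.padicValNat_tamagawaProduct_baseChange_of_heegner_prime (p := p) W K hK hN hHe
  haveI : Finite (W.baseChange K).sha := hfin
  have hsha : padicValNat p (Nat.card (AddCommGroup.primaryComponent (W.baseChange K).sha p)) =
      padicValNat p (W.baseChange K).shaOrder := by
    rw [Literature.NumberTheory.EllipticCurves.natCard_primaryComponent_eq_pow_padicValNat p,
      padicValNat.prime_pow]
    rfl
  rw [htam1, htam2, hsha]
  unfold IndexLowerBoundLeAt
  omega

variable [W.IsElliptic] [W.IsGloballyMinimal] {κ : ZpExtension K p} {𝔭 : HeightOneSpectrum (𝓞 K)}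
  {γ : Field.absoluteGaloisGroup K} [Fact (κ.IsTopGenerator γ)] {ι : K →+* ℚ_[p]}

/-- **STEP L at the datum + the control equality at a frame ⟹ T-B6-1 (slack `s`) at that frame** (`Ш(E/K)`
finite, `K` a classical Heegner field for `N_E`). [cite: JetchevSkinnerWan2017, §7.4.1 (arXiv:1512.06894 p. 30)] -/
theorem additiveIMCLowerBDPOnTreeLeAt_of_indexLowerBoundLeAt_of_control (hN : W.conductorNorm ℤ = N)
    (hK : IsImaginaryQuadratic K) (hHe : SatisfiesHeegnerHypothesis N K)
    (hfin : (W.baseChange K).ShaFinite) (hI : IndexLowerBoundLeAt W p K P s)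
    (h2 : AdditiveControlOnTreeAt p κ 𝔭 γ ι P) : AdditiveIMCLowerBDPOnTreeLeAt p κ 𝔭 γ ι s P := by
  have hI' := (indexLowerBoundLeAt_iff_of_heegner_of_shaFinite hN hK hHe hfin).mp hI
  obtain ⟨n, hn, heq⟩ := h2
  exact ⟨n, hn, by omega⟩

/-- **T-B6-1 (slack `s`) + the control equality at ONE frame ⟹ STEP L at the datum** (the forward
bookkeeping of the sockets, read in `IndexLowerBoundLeAt` currency; `Ш(E/K)` finite).
[cite: JetchevSkinnerWan2017, §7.4.1 (arXiv:1512.06894 p. 30)] -/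
theorem indexLowerBoundLeAt_of_imcLowerLe_of_control (hN : W.conductorNorm ℤ = N)
    (hK : IsImaginaryQuadratic K) (hHe : SatisfiesHeegnerHypothesis N K)
    (hfin : (W.baseChange K).ShaFinite) (h1 : AdditiveIMCLowerBDPOnTreeLeAt p κ 𝔭 γ ι s P)
    (h2 : AdditiveControlOnTreeAt p κ 𝔭 γ ι P) : IndexLowerBoundLeAt W p K P s :=
  (indexLowerBoundLeAt_iff_of_heegner_of_shaFinite hN hK hHe hfin).mpr
    (index_le_slack_of_additive_links h1 h2)

end Datum

/-! ### §2 On a pair `(W, p)`: STEP L♯ ⟺ T-B6-1♯, given Kolyvagin and the control input -/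

section Pair

variable {W : WeierstrassCurve ℚ} [W.IsElliptic] [W.IsGloballyMinimal] {p : ℕ} [Fact p.Prime]

/-- **STEP L♯ ⟹ T-B6-1♯ on a pair**, given Kolyvagin's finiteness of `Ш(E/K)` at non-torsion Heegner
points of `W` and the Manin-robust control input `AdditiveControlInputManinAt W p` (the control corner's
conclusion): at EVERY datum and EVERY frame of the branch socket, STEP L at that datum and the control
equality at that frame give the slack-`v_p(c)` branch inequality. This is the direction the tree did not
have: the branch cruxes COST no more than STEP L. [cite: JetchevSkinnerWan2017, §7.4.1 (arXiv:1512.06894 p. 30)] [cite: Gross1991, Thm. 1.3] -/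
theorem additiveIMCLowerBDPInputManinAt_of_kolyvagin_of_control_of_stepL
    (hKo : ∀ (N : ℕ) [NeZero N] (K : Type) [Field K] [NumberField K], kolyvagin N W K)
    (h4 : AdditiveControlInputManinAt W p) (hL : AdditiveStepLInputManinAt W p) :
    AdditiveIMCLowerBDPInputManinAt W p := by
  intro N _ K _ _ Dt H ι P hr hloc hN hK hodd hunit hHe hLd hP hnt κ hκ γ _ 𝔭 h𝔭 he hf
  have hfin : (W.baseChange K).ShaFinite := (hKo N K hK hHe ⟨Dt, H, ι, hP⟩ hnt).2
  exact additiveIMCLowerBDPOnTreeLeAt_of_indexLowerBoundLeAt_of_control hN hK hHe hfin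
    (hL N K Dt H ι P hr hloc hN hK hodd hunit hHe hLd hP hnt)
    (h4 N K Dt H ι P hr hloc hN hK hodd hunit hHe hLd hP hnt κ hκ γ 𝔭 h𝔭 he hf)

/-- **T-B6-1♯ ⟹ STEP L♯ on a pair**, given Kolyvagin for `W` and the Manin-robust control input (the
sockets' forward bookkeeping at a frame, which exists: an anticyclotomic `ℤ_p`-extension with a
topological generator, `X11b.exists_anticyclotomic_generator_prime`, and a degree-one `𝔭 ∣ p`, as `p` is
additive, so `p ∣ N_E` splits in the Heegner field). Theses-free form of door-c2's
`additiveStepLInputManinAt_of_kolyvagin_of_potMult_of_control`. [cite: JetchevSkinnerWan2017, §7.4.1 (arXiv:1512.06894 p. 30)] [cite: Gross1991, Thm. 1.3] -/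
theorem additiveStepLInputManinAt_of_kolyvagin_of_control_of_imcLower
    (hKo : ∀ (N : ℕ) [NeZero N] (K : Type) [Field K] [NumberField K], kolyvagin N W K)
    (h4 : AdditiveControlInputManinAt W p) (h1 : AdditiveIMCLowerBDPInputManinAt W p) :
    AdditiveStepLInputManinAt W p := by
  intro N _ K _ _ Dt H ι P hr hloc hN hK hodd hunit hHe hLd hP hnt
  have hp : p.Prime := Fact.out
  have hfin : (W.baseChange K).ShaFinite := (hKo N K hK hHe ⟨Dt, H, ι, hP⟩ hnt).2
  -- `p` is additive, so `p ∣ N_E`, so `p` splits in the Heegner field `K`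
  have hpN : p ∣ W.conductorNorm ℤ :=
    (W.dvd_conductorNorm_iff_not_hasGoodReductionAtPrime p).mpr (not_good_of_addv W p hloc.2.1)
  have hsplit : SplitsIn K p := hHe p hp (hN ▸ hpN)
  -- a frame: anticyclotomic `κ`, topological generator `γ`, degree-one `𝔭 ∣ p`
  obtain ⟨κ, γ, -, hκ, hγ, -⟩ := X11b.exists_anticyclotomic_generator_prime (p := p) hK
  haveI : Fact (κ.IsTopGenerator γ) := ⟨hγ⟩
  obtain ⟨𝔭, h𝔭, he, hf⟩ := X11b.exists_degreeOnePrime_of_splitsIn K p hK.1 hsplit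
  exact indexLowerBoundLeAt_of_imcLowerLe_of_control hN hK hHe hfin
    (h1 N K Dt H ι P hr hloc hN hK hodd hunit hHe hLd hP hnt κ hκ γ 𝔭 h𝔭 he hf)
    (h4 N K Dt H ι P hr hloc hN hK hodd hunit hHe hLd hP hnt κ hκ γ 𝔭 h𝔭 he hf)

/-- **STEP L♯ ⟺ T-B6-1♯ on every pair of the door, given Kolyvagin and the control input.** Read on the
route: under `PrintedFacts`' Kolyvagin conjunct and the conclusion of the control corner
(`AnticycControlAdditiveKF`, items 19295/19548, closed modulo one LCFT fact), the target `StepLManin`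
restricted to (M) is EQUIVALENT to `PotMultBranchIMC`, and restricted to (G-ord, `e = 2`) to
`GordTwoBranchIMC` — the cruxes are exactly as strong as the target, and the route header's «cheapest
falsifier» (STEP L pair by pair; kit j261157: 40/40 with equality) tests the cruxes themselves.
[cite: JetchevSkinnerWan2017, §7.4.1 (arXiv:1512.06894 p. 30)] [cite: Gross1991, Thm. 1.3 and Conj. (2.2)] -/
theorem additiveStepLInputManinAt_iff_imcLowerBDPInputManinAt_of_kolyvagin_of_control
    (hKo : ∀ (N : ℕ) [NeZero N] (K : Type) [Field K] [NumberField K], kolyvagin N W K)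
    (h4 : AdditiveControlInputManinAt W p) :
    AdditiveStepLInputManinAt W p ↔ AdditiveIMCLowerBDPInputManinAt W p :=
  ⟨additiveIMCLowerBDPInputManinAt_of_kolyvagin_of_control_of_stepL hKo h4,
    additiveStepLInputManinAt_of_kolyvagin_of_control_of_imcLower hKo h4⟩

end Pair

end Summit.BirchSwinnertonDyer.BirchSwinnertonDyer.Theorems.SchneiderFreeAdditiveX3

end
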